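import Mathlib
import Summits.Ventures.FusionMHD.Models.RwmFRS1Kq08Chain
import Summits.Ventures.FusionMHD.Models.RwmFRS1Solution
import Literature.Analysis.ODE.LinearSecondOrder
import HarnessLib

/-!
# F3.r4 instance «RwmFRS1Kq08» ((2,1) RWM of the `q₀ = 4/5` member): THE axis-regular solution `ξ₁` of Newcomb's marginal
# equation on the whole plasma, its sign, and `L_8 = aξ₁′(a)/ξ₁(a) ∈ (3.9795679, 3.9795680)`

Port of `RwmFRS1Kq07Solution.lean` (model-6 g7) to MODEL M_RWM,8 (`RwmFRS1Kq08.lean`: the exact force-balanced `q₀ = 4/5`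
screw pinch `Kq08.P8`, mode `(2,1)`) over `RwmFRS1Kq08AxisValues.lean` (ODD branch `ξ = r·h(r²)`, series
used for `|r| < 1/2`) and `RwmFRS1Kq08Chain.lean` (kernel Taylor chain `axisK8`, 22 stages, `1/4 → 1`): `solR`,
`solR_eq_axisXi`, **`xi`** (series for `|r| < 2/5`, `R(r)` beyond on the right, `−R(−r)` on the left: the odd `C¹`
continuation — for `m = 2` the regular branch `ξ ∝ r^{m−1} = r` is ODD, unlike the even `r²h(r²)` of the `(3,1)` rows),
`xi_contDiffOn` (`C¹` on `(−51/50, 51/50)`), `xi_newcomb`, `xi_axis` (`ξ₁(r)/r → 1`), `xi_pos` on `(0,1]`, edge boxes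
`ξ(1) = 2.2961427018872 ± 2·10⁻¹¹`, `ξ′(1) = 9.1376559190451 ± 6·10⁻¹¹`, **`L_bounds`: `3.9795679 < L_8 < 3.9795680`**
(VALIDATED float RK4 `3.979568`, work/preview/preview_q0.py; model-6 g8). [instance data]
-/

noncomputable section

open Set Filter Polynomial Literature.Analysis.ODE Literature.Computation.Certificates
  Literature.Computation.Certificates.LinearODE Literature.MathematicalPhysics.MHD
open scoped Topology ContDiff

namespace Summit.Ventures.FusionMHD.Models

namespace RwmFRS1

namespace Kq08

/-! ### The solved-form coefficients are smooth on `(0, 21/20)` -/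

/-- `𝔭 = −P₁/P₂` is `C^∞` on `(0, 21/20)`. [instance data] -/
theorem contDiffOn_pH : ContDiffOn ℝ ∞ Kq08.rwmEq2p.pH (Ioo 0 (21 / 20)) := by
  have e : Kq08.rwmEq2p.pH = fun u => -((toPolyR Kq08.rwmEq2p.P1).eval u / (toPolyR Kq08.rwmEq2p.P2).eval u) := rfl
  rw [e]
  refine ContDiffOn.neg (ContDiffOn.div ?_ ?_ fun r hr => eval_P2_ne_zero hr.1 (by obtain ⟨h0, h1⟩ := hr; nlinarith))
  · exact (contDiff_eval _).contDiffOn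
  · exact (contDiff_eval _).contDiffOn

/-- `𝔮 = −P₀/P₂` is `C^∞` on `(0, 21/20)`. [instance data] -/
theorem contDiffOn_qH : ContDiffOn ℝ ∞ Kq08.rwmEq2p.qH (Ioo 0 (21 / 20)) := by
  have e : Kq08.rwmEq2p.qH = fun u => -((toPolyR Kq08.rwmEq2p.P0).eval u / (toPolyR Kq08.rwmEq2p.P2).eval u) := rfl
  rw [e]
  refine ContDiffOn.neg (ContDiffOn.div ?_ ?_ fun r hr => eval_P2_ne_zero hr.1 (by obtain ⟨h0, h1⟩ := hr; nlinarith))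
  · exact (contDiff_eval _).contDiffOn
  · exact (contDiff_eval _).contDiffOn

/-- Continuity of `𝔭`, `𝔮` on `(0, 21/20)`. [instance data] -/
theorem continuousOn_pH_qH :
    ContinuousOn Kq08.rwmEq2p.pH (Ioo 0 (21 / 20)) ∧ ContinuousOn Kq08.rwmEq2p.qH (Ioo 0 (21 / 20)) :=
  ⟨contDiffOn_pH.continuousOn, contDiffOn_qH.continuousOn⟩

/-! ### A global solution through the axis data (coefficients frozen beyond `26/25`) -/

/-- The coefficient `𝔭` frozen at `r = 26/25`: continuous on `(0, ∞)`, equal to `𝔭` on `(0, 26/25]`. [instance data] -/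
def pCut (r : ℝ) : ℝ := Kq08.rwmEq2p.pH (min r (26 / 25))

/-- The coefficient `𝔮` frozen at `r = 26/25`. [instance data] -/
def qCut (r : ℝ) : ℝ := Kq08.rwmEq2p.qH (min r (26 / 25))

/-- The frozen coefficients are continuous on `(0, ∞)`. [instance data] -/
theorem continuousOn_cut : ContinuousOn Kq08.pCut (Ioi 0) ∧ ContinuousOn Kq08.qCut (Ioi 0) := by
  have hmin : ContinuousOn (fun r : ℝ => min r (26 / 25)) (Ioi 0) := (continuous_id.min continuous_const).continuousOn
  exact ⟨continuousOn_pH_qH.1.comp hmin RwmFRS1.min_mapsTo, continuousOn_pH_qH.2.comp hmin RwmFRS1.min_mapsTo⟩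

/-- A global solution on `(0, ∞)` of the frozen equation through the AXIS DATA at `r = 1/4`. [cite: Hartman2002, Ch. IV Lemma 1.1] -/
theorem cutSolution_exists : ∃ u u' : ℝ → ℝ, u (1 / 4) = Kq08.axisXi (1 / 4) ∧ u' (1 / 4) = Kq08.axisXi' (1 / 4) ∧
    ∀ t ∈ Ioi (0 : ℝ), HasDerivAt u (u' t) t ∧ HasDerivAt u' (Kq08.pCut t * u' t + Kq08.qCut t * u t) t :=
  exists_solution_Ioi (𝕜 := ℝ) continuousOn_cut.1 continuousOn_cut.2 (1 / 4) (axisXi (1 / 4)) (axisXi' (1 / 4))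

/-- THE CONTINUED SOLUTION `R` (a choice of the above). [instance data] -/
def solR : ℝ → ℝ := Classical.choose cutSolution_exists

/-- Its derivative function. [instance data] -/
def solR' : ℝ → ℝ := Classical.choose (Classical.choose_spec cutSolution_exists)

/-- Defining properties: the axis data at `1/4` and the frozen equation on `(0, ∞)`. [instance data] -/
theorem solR_spec : Kq08.solR (1 / 4) = Kq08.axisXi (1 / 4) ∧ Kq08.solR' (1 / 4) = Kq08.axisXi' (1 / 4) ∧
    ∀ t ∈ Ioi (0 : ℝ), HasDerivAt Kq08.solR (Kq08.solR' t) t ∧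
      HasDerivAt Kq08.solR' (Kq08.pCut t * Kq08.solR' t + Kq08.qCut t * Kq08.solR t) t :=
  Classical.choose_spec (Classical.choose_spec cutSolution_exists)

/-- On `(0, 26/25)` the frozen equation IS the marginal equation: `(R, R′)` solves `Kq08.rwmEq2p` there. [instance data] -/
theorem solR_isSolOn : Kq08.rwmEq2p.IsSolOn Kq08.solR Kq08.solR' (Ioo 0 (26 / 25)) := by
  intro t ht
  obtain ⟨h1, h2⟩ := solR_spec.2.2 t ht.1
  have hm : min t (26 / 25) = t := min_eq_left ht.2.le
  refine ⟨h1, ?_⟩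
  simpa only [pCut, qCut, hm] using h2

/-- `R` coincides with the Frobenius branch `ξ = r·h(r²)` on `(0, 1/2)` (uniqueness through the common data at `1/4`).
[cite: Hartman2002, Ch. IV Lemma 1.1] -/
theorem solR_eq_axisXi : EqOn Kq08.solR Kq08.axisXi (Ioo 0 (1 / 2)) ∧ EqOn Kq08.solR' Kq08.axisXi' (Ioo 0 (1 / 2)) := by
  have hsub : Ioo (0 : ℝ) (1 / 2) ⊆ Ioo 0 (21 / 20) := fun r hr => ⟨hr.1, by linarith [hr.2]⟩
  have hsub' : Ioo (0 : ℝ) (1 / 2) ⊆ Ioo 0 (26 / 25) := fun r hr => ⟨hr.1, by linarith [hr.2]⟩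
  exact eqOn_of_solution_Ioo (𝕜 := ℝ) (continuousOn_pH_qH.1.mono hsub) (continuousOn_pH_qH.2.mono hsub)
    (t₀ := 1 / 4) ⟨by norm_num, by norm_num⟩ (fun t ht => solR_isSolOn t (hsub' ht)) (fun t ht => axisXi_isSolOn t ht)
    solR_spec.1 solR_spec.2.1

/-- `R` is `C^∞` on `(0, 26/25)` (smooth coefficients). [cite: Hartman2002, Ch. V Cor. 4.1] -/
theorem solR_contDiffOn : ContDiffOn ℝ ∞ Kq08.solR (Ioo 0 (26 / 25)) ∧ ContDiffOn ℝ ∞ Kq08.solR' (Ioo 0 (26 / 25)) := by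
  have hsub : Ioo (0 : ℝ) (26 / 25) ⊆ Ioo 0 (21 / 20) := fun r hr => ⟨hr.1, by linarith [hr.2]⟩
  exact contDiffOn_of_solution (𝕜 := ℝ) isOpen_Ioo (contDiffOn_pH.mono hsub) (contDiffOn_qH.mono hsub)
    fun t ht => solR_isSolOn t ht

/-! ### THE axis-regular solution as one (odd) function on `ℝ` -/

/-- **THE AXIS-REGULAR SOLUTION `ξ₁`** of Newcomb's marginal equation for MODEL M_RWM,8, mode `(2,1)`: the Frobenius branch
`r·h(r²)` for `|r| < 2/5`, its continuation `R(r)` on the right and the ODD reflection `−R(−r)` on the left. [instance data] -/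
def xi (r : ℝ) : ℝ := if |r| < 2 / 5 then Kq08.axisXi r else if 0 < r then Kq08.solR r else -Kq08.solR (-r)

/-- `ξ(r) = r·h(r²)` is odd: `axisXi (−r) = −axisXi r`. [instance data] -/
theorem axisXi_neg (r : ℝ) : Kq08.axisXi (-r) = -Kq08.axisXi r := by
  simp only [axisXi, pow_one, neg_sq, neg_mul]

/-- `ξ₁ = r·h(r²)` for `|r| < 1/2`. [instance data] -/
theorem xi_eq_axisXi {r : ℝ} (hr : |r| < 1 / 2) : Kq08.xi r = Kq08.axisXi r := by
  unfold xi
  split_ifs with h h'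
  · rfl
  · rw [not_lt] at h
    have hr' : r < 1 / 2 := lt_of_le_of_lt (le_abs_self r) hr
    exact solR_eq_axisXi.1 ⟨h', hr'⟩
  · rw [not_lt] at h h'
    have hneg : 0 < -r := by
      rcases lt_or_eq_of_le h' with hlt | heq
      · linarith
      · exfalso; rw [heq, abs_zero] at h; linarith
    have hr' : -r < 1 / 2 := lt_of_le_of_lt (neg_le_abs r) hr
    rw [solR_eq_axisXi.1 ⟨hneg, hr'⟩, axisXi_neg, neg_neg]

/-- On `0 < r`: `ξ₁ = R`. [instance data] -/
theorem xi_eq_solR_of_pos {r : ℝ} (h0 : 0 < r) : Kq08.xi r = Kq08.solR r := by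
  unfold xi
  split_ifs with h
  · have : r < 1 / 2 := by rw [abs_of_pos h0] at h; linarith
    exact (solR_eq_axisXi.1 ⟨h0, this⟩).symm
  · rfl

/-- On `r < 0`: `ξ₁(r) = −R(−r)` (odd continuation). [instance data] -/
theorem xi_eq_neg_solR_of_neg {r : ℝ} (h0 : r < 0) : Kq08.xi r = -Kq08.solR (-r) := by
  unfold xi
  split_ifs with h h'
  · have : -r < 1 / 2 := by rw [abs_of_neg h0] at h; linarith
    rw [solR_eq_axisXi.1 ⟨by linarith, this⟩, axisXi_neg, neg_neg]
  · exfalso; linarith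
  · rfl

/-- `ξ₁` agrees with `R` near every point of `(0, 26/25)`. [instance data] -/
theorem xi_eventuallyEq_solR {r : ℝ} (hr : r ∈ Ioo (0 : ℝ) (26 / 25)) : Kq08.xi =ᶠ[𝓝 r] Kq08.solR := by
  filter_upwards [isOpen_Ioo.mem_nhds hr] with x hx
  exact xi_eq_solR_of_pos hx.1

/-- **`(ξ₁, R′)` SOLVES THE MARGINAL EQUATION on `(0, 26/25)`** (certificate sense). [instance data] -/
theorem xi_isSolOn : Kq08.rwmEq2p.IsSolOn Kq08.xi Kq08.solR' (Ioo 0 (26 / 25)) := by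
  intro r hr
  obtain ⟨h1, h2⟩ := solR_isSolOn r hr
  refine ⟨h1.congr_of_eventuallyEq (xi_eventuallyEq_solR hr), ?_⟩
  rw [xi_eq_solR_of_pos hr.1]
  exact h2

/-- `deriv ξ₁ = R′` on `(0, 26/25)`. [instance data] -/
theorem deriv_xi {r : ℝ} (hr : r ∈ Ioo (0 : ℝ) (26 / 25)) : deriv Kq08.xi r = Kq08.solR' r := (xi_isSolOn r hr).1.deriv

/-- **NEWCOMB'S EQUATION IN lit-4's FORM**: `d/dr (f · deriv ξ₁) = g ξ₁` at every `r ∈ (0, 26/25)` for MODEL M_RWM,8.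
[cite: Freidberg2014, §11.5.3 eq. (11.110)] -/
theorem xi_newcomb {r : ℝ} (hr : r ∈ Ioo (0 : ℝ) (26 / 25)) :
    HasDerivAt (fun x => P8.newcombF 2 kk x * deriv Kq08.xi x) (P8.newcombG 2 kk r * Kq08.xi r) r :=
  newcomb_of_isSolOn isOpen_Ioo (fun x hx => ⟨hx.1, by nlinarith [hx.1, hx.2]⟩) xi_isSolOn hr

/-- **REGULARITY AT THE AXIS**: `ξ₁(r)/r → 1` as `r → 0` (`ξ₁ ∝ r^{m−1}`, `m = 2`, as printed). [instance data] -/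
theorem xi_axis : Tendsto (fun r => Kq08.xi r / r) (𝓝[≠] 0) (𝓝 1) := by
  have hC := axisH_contDiffOn.1.continuousOn
  have h0 : (0 : ℝ) ∈ Metric.ball (0 : ℝ) (2 / 7) := Metric.mem_ball_self (by norm_num)
  have hc : ContinuousAt (fun t => (Kq08.axisH t).1) 0 := hC.continuousAt (Metric.isOpen_ball.mem_nhds h0)
  have hsq : Tendsto (fun r : ℝ => r ^ 2) (𝓝[≠] 0) (𝓝 0) := by
    have : Tendsto (fun r : ℝ => r ^ 2) (𝓝 0) (𝓝 0) := by
      simpa using ((continuous_pow 2).tendsto (0 : ℝ))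
    exact this.mono_left nhdsWithin_le_nhds
  have hlim : Tendsto (fun r : ℝ => (Kq08.axisH (r ^ 2)).1) (𝓝[≠] 0) (𝓝 1) := by
    have h := hc.tendsto.comp hsq
    rw [axisH_zero] at h
    exact h
  refine hlim.congr' ?_
  have hnb : ∀ᶠ r in 𝓝[≠] (0 : ℝ), r ≠ 0 ∧ |r| < 2 / 5 := by
    have h1 : ∀ᶠ r in 𝓝[≠] (0 : ℝ), r ≠ 0 := self_mem_nhdsWithin
    have h2 : ∀ᶠ r in 𝓝[≠] (0 : ℝ), |r| < 2 / 5 := by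
      have : ∀ᶠ r in 𝓝 (0 : ℝ), |r| < 2 / 5 := by
        have := Metric.ball_mem_nhds (0 : ℝ) (by norm_num : (0 : ℝ) < 2 / 5)
        filter_upwards [this] with r hr
        simpa [Real.dist_eq] using hr
      exact this.filter_mono nhdsWithin_le_nhds
    exact h1.and h2
  filter_upwards [hnb] with r hr
  rw [xi_eq_axisXi (by linarith [hr.2]), axisXi, pow_one, mul_comm, mul_div_assoc, div_self hr.1, mul_one]

/-! ### `ξ₁` is `C¹` through the axis -/

/-- `r ↦ r·h(r²)` is `C¹` at every `|r| < 1/2` (composition with the analytic `h`). [instance data] -/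
theorem axisXi_contDiffAt {r : ℝ} (hr : |r| < 1 / 2) : ContDiffAt ℝ 1 Kq08.axisXi r := by
  have hball : r ^ 2 ∈ Metric.ball (0 : ℝ) (2 / 7) := by
    rw [Metric.mem_ball, Real.dist_eq, sub_zero, abs_of_nonneg (sq_nonneg r)]
    have : |r| ^ 2 < (1 / 2) ^ 2 := by
      exact pow_lt_pow_left₀ hr (abs_nonneg r) two_ne_zero
    rw [sq_abs] at this
    linarith
  have hh : ContDiffAt ℝ 1 (fun t => (Kq08.axisH t).1) (r ^ 2) :=
    axisH_contDiffOn.1.contDiffAt (Metric.isOpen_ball.mem_nhds hball)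
  have hsq : ContDiff ℝ 1 (fun x : ℝ => x ^ 2) := contDiff_id.pow 2
  have hcomp : ContDiffAt ℝ 1 (fun x : ℝ => (Kq08.axisH (x ^ 2)).1) r :=
    ContDiffAt.comp (g := fun t => (Kq08.axisH t).1) (f := fun x : ℝ => x ^ 2) r hh hsq.contDiffAt
  have e : Kq08.axisXi = fun x : ℝ => x ^ 1 * (Kq08.axisH (x ^ 2)).1 := by funext x; rfl
  rw [e]
  exact (contDiff_id.pow 1).contDiffAt.mul hcomp

/-- `R` is `C¹` at every `2/5 < r < 26/25`. [instance data] -/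
theorem solR_contDiffAt {r : ℝ} (h0 : 2 / 5 < r) (h1 : r < 26 / 25) : ContDiffAt ℝ 1 Kq08.solR r :=
  (solR_contDiffOn.1.of_le (by exact_mod_cast le_top)).contDiffAt (isOpen_Ioo.mem_nhds ⟨by linarith, h1⟩)

/-- `r ↦ −R(−r)` is `C¹` at every `−26/25 < r < −2/5`. [instance data] -/
theorem neg_solR_neg_contDiffAt {r : ℝ} (h0 : r < -(2 / 5)) (h1 : -(26 / 25) < r) :
    ContDiffAt ℝ 1 (fun x => -Kq08.solR (-x)) r := by
  have hR : ContDiffAt ℝ 1 Kq08.solR (-r) := solR_contDiffAt (by linarith) (by linarith)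
  have hneg : ContDiffAt ℝ 1 (fun x : ℝ => -x) r := contDiff_neg.contDiffAt
  exact (ContDiffAt.comp (g := Kq08.solR) (f := fun x : ℝ => -x) r hR hneg).neg

/-- **`ξ₁ ∈ C¹(−51/50, 51/50)`** — regular THROUGH the axis (`ξ₁ = r·h(r²)` near `0`), the regularity hypothesis of
Newcomb's external-mode test. [instance data] -/
theorem xi_contDiffOn : ContDiffOn ℝ 1 Kq08.xi (Ioo (-(51 / 50)) (51 / 50)) := by
  intro r hr
  rcases lt_or_ge (|r|) (9 / 20) with hlt | hge
  · -- near `r`: `ξ₁ = axisXi`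
    have hev : Kq08.xi =ᶠ[𝓝 r] Kq08.axisXi := by
      have hopen : IsOpen {x : ℝ | |x| < 1 / 2} := isOpen_lt continuous_abs continuous_const
      filter_upwards [hopen.mem_nhds (show |r| < 1 / 2 by linarith)] with x hx
      exact xi_eq_axisXi hx
    exact ((axisXi_contDiffAt (by linarith)).congr_of_eventuallyEq hev).contDiffWithinAt
  · rcases lt_or_gt_of_ne (show r ≠ 0 by intro h; rw [h, abs_zero] at hge; linarith) with hneg | hpos
    · -- `r < 0`: near `r`, `ξ₁ = −R(−·)`
      have hr' : r ≤ -(9 / 20) := by rw [abs_of_neg hneg] at hge; linarith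
      have hev : Kq08.xi =ᶠ[𝓝 r] fun x => -Kq08.solR (-x) := by
        filter_upwards [isOpen_Iio.mem_nhds (show r < -(2 / 5) by linarith)] with x hx
        exact xi_eq_neg_solR_of_neg (by linarith [hx.out])
      exact ((neg_solR_neg_contDiffAt (by linarith) (by linarith [hr.1])).congr_of_eventuallyEq hev).contDiffWithinAt
    · -- `r > 0`: near `r`, `ξ₁ = R`
      have hr' : 9 / 20 ≤ r := by rw [abs_of_pos hpos] at hge; exact hge
      have hev : Kq08.xi =ᶠ[𝓝 r] Kq08.solR := by
        filter_upwards [isOpen_Ioi.mem_nhds (show 2 / 5 < r by linarith)] with x hx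
        exact xi_eq_solR_of_pos (by linarith [hx.out])
      exact ((solR_contDiffAt (by linarith) (by linarith [hr.2])).congr_of_eventuallyEq hev).contDiffWithinAt

/-! ### Sign: `ξ₁ > 0` on `(0, 1]` -/

/-- The flux `φ = f · ξ₁′` is continuous on `(0, 26/25)`. [instance data] -/
theorem flux_continuousOn :
    ContinuousOn (fun x => P8.newcombF 2 kk x * deriv Kq08.xi x) (Ioo 0 (26 / 25)) :=
  fun _ hr => (xi_newcomb hr).continuousAt.continuousWithinAt

/-- `ξ₁` is continuous on `(0, 26/25)`. [instance data] -/
theorem xi_continuousOn : ContinuousOn Kq08.xi (Ioo 0 (26 / 25)) :=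
  fun r hr => (xi_isSolOn r hr).1.continuousAt.continuousWithinAt

/-- `ξ₁′(1/4) > 0` and `ξ₁(1/4) > 0` (from the axis boxes). [instance data] -/
theorem data_quarter_pos : 0 < Kq08.xi (1 / 4) ∧ 0 < deriv Kq08.xi (1 / 4) := by
  have hq : (1 / 4 : ℝ) ∈ Ioo (0 : ℝ) (26 / 25) := ⟨by norm_num, by norm_num⟩
  rw [deriv_xi hq, xi_eq_solR_of_pos (by norm_num), solR_spec.1, solR_spec.2.1]
  refine ⟨axisXi_pos (by norm_num) le_rfl, ?_⟩
  have h := axisXi'_val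
  have h' := (abs_sub_le_iff.1 h).2
  norm_num at h'
  linarith

/-- **`ξ₁ > 0` ON `[1/4, 1]`.** First-zero argument: on `[1/4, z)` before a first zero `z`, `(fξ₁′)′ = gξ₁ ≥ 0`
(`g > 0` on the plasma), so `fξ₁′ ≥ (fξ₁′)(1/4) > 0`, so `ξ₁` increases and cannot vanish at `z`. [instance data] -/
theorem xi_pos_Icc : ∀ r ∈ Icc (1 / 4 : ℝ) 1, 0 < Kq08.xi r := by
  by_contra hneg
  push Not at hneg
  obtain ⟨r₁, hr₁, hle⟩ := hneg
  set Z : Set ℝ := Icc (1 / 4 : ℝ) 1 ∩ Kq08.xi ⁻¹' (Iic 0) with hZ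
  have hsub : Icc (1 / 4 : ℝ) 1 ⊆ Ioo 0 (26 / 25) := fun x hx => ⟨by linarith [hx.1], by linarith [hx.2]⟩
  have hZc : IsClosed Z := (xi_continuousOn.mono hsub).preimage_isClosed_of_isClosed isClosed_Icc isClosed_Iic
  have hZne : Z.Nonempty := ⟨r₁, hr₁, hle⟩
  have hZbdd : BddBelow Z := ⟨1 / 4, fun x hx => hx.1.1⟩
  set z := sInf Z with hz
  have hzZ : z ∈ Z := hZc.csInf_mem hZne hZbdd
  obtain ⟨⟨hz1, hz2⟩, hzle⟩ := hzZ
  have hzle' : Kq08.xi z ≤ 0 := hzle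
  obtain ⟨hq0, hq1⟩ := data_quarter_pos
  have hzq : 1 / 4 < z := by
    rcases eq_or_lt_of_le hz1 with h | h
    · rw [← h] at hzle'; linarith
    · exact h
  have hbefore : ∀ x ∈ Ico (1 / 4 : ℝ) z, 0 < Kq08.xi x := by
    intro x hx
    by_contra hx0
    rw [not_lt] at hx0
    have hxZ : x ∈ Z := ⟨⟨hx.1, by linarith [hx.2]⟩, hx0⟩
    have := csInf_le hZbdd hxZ
    linarith [hx.2]
  have hIsub : Icc (1 / 4 : ℝ) z ⊆ Ioo 0 (26 / 25) := fun x hx => ⟨by linarith [hx.1], by linarith [hx.2]⟩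
  have hmono : MonotoneOn (fun x => P8.newcombF 2 kk x * deriv Kq08.xi x) (Icc (1 / 4) z) := by
    refine monotoneOn_of_deriv_nonneg (convex_Icc _ _) (flux_continuousOn.mono hIsub) ?_ ?_
    · rw [interior_Icc]
      intro x hx
      exact (xi_newcomb (hIsub (Ioo_subset_Icc_self hx))).differentiableAt.differentiableWithinAt
    · rw [interior_Icc]
      intro x hx
      rw [(xi_newcomb (hIsub (Ioo_subset_Icc_self hx))).deriv]
      have hg := newcombG_pos (show (0 : ℝ) < x by linarith [hx.1]) (show x ≤ 1 by linarith [hx.2])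
      exact (mul_pos hg (hbefore x ⟨hx.1.le, hx.2⟩)).le
  have hflux0 : 0 < P8.newcombF 2 kk (1 / 4) * deriv Kq08.xi (1 / 4) :=
    mul_pos (newcombF_pos (by norm_num) (by norm_num)) hq1
  have hderiv_pos : ∀ x ∈ Icc (1 / 4 : ℝ) z, 0 < deriv Kq08.xi x := by
    intro x hx
    have h1 := hmono ⟨le_rfl, hzq.le⟩ hx hx.1
    have hf := newcombF_pos (show (0 : ℝ) < x by linarith [hx.1]) (show x ^ 2 < 3 / 2 by nlinarith [hx.1, hx.2])
    by_contra hle0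
    rw [not_lt] at hle0
    have : P8.newcombF 2 kk x * deriv Kq08.xi x ≤ 0 := mul_nonpos_of_nonneg_of_nonpos hf.le hle0
    linarith
  have hximono : StrictMonoOn Kq08.xi (Icc (1 / 4) z) := by
    refine strictMonoOn_of_deriv_pos (convex_Icc _ _) ((xi_continuousOn.mono hIsub)) ?_
    rw [interior_Icc]
    intro x hx
    exact hderiv_pos x (Ioo_subset_Icc_self hx)
  have := hximono ⟨le_rfl, hzq.le⟩ ⟨hzq.le, le_rfl⟩ hzq
  linarith

/-- **`ξ₁ > 0` on `(0, 1]`** (and so `ξ₁ ≠ 0` there: internal-mode hypothesis of the external-mode test). [instance data] -/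
theorem xi_pos {r : ℝ} (h0 : 0 < r) (h1 : r ≤ 1) : 0 < Kq08.xi r := by
  rcases le_or_gt r (1 / 4) with hle | hgt
  · rw [xi_eq_axisXi (by rw [abs_of_pos h0]; linarith)]
    exact axisXi_pos h0 hle
  · exact xi_pos_Icc r ⟨hgt.le, h1⟩

/-- `ξ₁ ≠ 0` on `Ioc 0 1`. [instance data] -/
theorem xi_ne_zero : ∀ r ∈ Ioc (0 : ℝ) 1, Kq08.xi r ≠ 0 := fun _ hr => (xi_pos hr.1 hr.2).ne'

/-! ### The edge values and `L` -/

/-- **`ξ₁(1) = 2.2961427018872 ± 2·10⁻¹¹`** (kernel chain `1/4 → 1` on the axis boxes). [instance data] -/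
theorem xi_one_box : |Kq08.xi 1 - (2870178377359 / 1250000000000 : ℝ)| ≤ (1 / 50000000000 : ℝ) := by
  rw [xi_eq_solR_of_pos (by norm_num)]
  exact (edge_box solR_isSolOn (by norm_num) (by norm_num) solR_spec.1 solR_spec.2.1).1

/-- **`ξ₁′(1) = 9.1376559190451 ± 6·10⁻¹¹`**. [instance data] -/
theorem deriv_xi_one_box : |deriv Kq08.xi 1 - (91376559190451 / 10000000000000 : ℝ)| ≤ (3 / 50000000000 : ℝ) := by
  rw [deriv_xi ⟨by norm_num, by norm_num⟩]
  exact (edge_box solR_isSolOn (by norm_num) (by norm_num) solR_spec.1 solR_spec.2.1).2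

/-- **THE EDGE LOGARITHMIC DERIVATIVE `L_8 = aξ₁′(a)/ξ₁(a)`: `3.9795679 < L_8 < 3.9795680`** (`a = 1`).
VALIDATED (not load-bearing): float RK4 `3.979568`. [instance data] -/
theorem L_bounds : (39795679 / 10000000 : ℝ) < 1 * deriv Kq08.xi 1 / Kq08.xi 1 ∧
    1 * deriv Kq08.xi 1 / Kq08.xi 1 < (39795680 / 10000000 : ℝ) := by
  have h1 := abs_sub_le_iff.1 xi_one_box
  have h2 := abs_sub_le_iff.1 deriv_xi_one_box
  have hpos : 0 < Kq08.xi 1 := xi_pos one_pos le_rfl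
  rw [one_mul, lt_div_iff₀ hpos, div_lt_iff₀ hpos]
  constructor <;> nlinarith [h1.1, h1.2, h2.1, h2.2]

end Kq08

end RwmFRS1

end Summit.Ventures.FusionMHD.Models

end
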